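import Literature.NumberTheory.Automorphic.IdeleClassGroupAutomorphicQuotientProofs
import Literature.NumberTheory.Automorphic.AdicCompletionCompact
import HarnessLib

/-!
# Small rational adeles vanish; real rescaling of adeles
(Cassels–Fröhlich, *Algebraic Number Theory* (1967), Ch. II §12 (product formula) and §14
(Theorem: `k` discrete in `V_k`); Getz–Hahn (2024), proof of Lemma 9.4.2 and §9.5, the
"observation" that an element of `F` lying in `F + aω` for `|a|` large …; Godement,
Sém. Bourbaki 257 (1962/63), proof of Thm. 9, Lemma 3)

Ingredients of the **parabolic lemma** behind the basic estimate for cusp forms on `GL_n`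
(a rational matrix whose lower-left block is the product of a small real number and an adelic
matrix with entries in a fixed compact set has zero lower-left block, i.e. lies in the parabolic
`P_k(K)`): seventh layer (part b) of the `provefact` decomposition of
`AutomorphicGLn.isDiscretelyDecomposable_cuspidal`. All statements are proved (Mathlib and the
tree's `AdeleRingTopology`):

* `FiniteAdeleRing.exists_ne_zero_forall_mem_mul_mem` — **common denominators on compact sets**:
  for a compact `B ⊆ 𝔸_K^∞` there is a non-zero `d ∈ 𝓞 K` with `d · B ⊆ ∏_v 𝒪_v` (finite
  subcover of the open sets `{a : d a integral}`, `FiniteAdeleRing.exists_ne_zero_forall_mul_mem`).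
* `exists_nhds_forall_algebraMap_eq_zero` — **small rational adeles vanish**: for a compact
  `B ⊆ 𝔸_K^∞` there is a neighbourhood `W` of `0` in `K_∞` such that the only `k ∈ K` whose finite
  component lies in `B` and whose archimedean component lies in `W` is `k = 0` (multiply by the
  common denominator `d`: `d k` is a global integer that is small at the archimedean places, hence
  `0` by the discreteness of `𝓞 K` in `K_∞`, `InfiniteAdeleRing.exists_isOpen_forall_integer_eq_zero`).
  This is the quantitative form of "`K` is discrete in `𝔸_K`" used in reduction theory
  (Cassels–Fröhlich II §14; Godement's Lemma 3; Getz–Hahn's proof of Lemma 9.4.2).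
* `exists_pos_forall_sum_realToInfiniteAdele_mul_mem` — **real rescaling**: for a neighbourhood
  `W` of `0` in `K_∞`, a compact `B_∞ ⊆ K_∞` and `L ∈ ℕ`, there is `ε > 0` such that
  `Σ_{l<L} r_l · b_l ∈ W` whenever `|r_l| ≤ ε` and `b_l ∈ B_∞` (`r · b` = multiplication by the
  diagonal real scalar `realToInfiniteAdele K r`; continuity and the tube lemma).

## References

* J. W. S. Cassels, A. Fröhlich (eds.), *Algebraic Number Theory* (1967), Ch. II §12, §14
  [CasselsFrohlichANT1967].
* R. Godement, *Domaines fondamentaux des groupes arithmétiques*, Sém. Bourbaki 257 (1962/63), §10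
  Lemma 3 (English translation in Borel–Godement–Siegel–Weil (2020), PDF p. 171).
* J. R. Getz, H. Hahn, *An Introduction to Automorphic Representations*, GTM 300 (2024), proof of
  Lemma 9.4.2 (printed p. 183) [GetzHahn2024].
-/

noncomputable section

open NumberField IsDedekindDomain Set Filter Topology

namespace Literature.NumberTheory.Automorphic

section Finite

variable (K : Type) [Field K] [NumberField K]

/-- **Common denominators on compact sets of finite adeles**: for a compact `B ⊆ 𝔸_K^∞` there is a
non-zero `d ∈ 𝓞 K` such that `d a` is integral at every finite place for every `a ∈ B` (each `a`
has such a `d_a`, the set where `d_a` works is open, extract a finite subcover and multiply the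
denominators). Cassels–Fröhlich II §14. [folklore] -/
theorem FiniteAdeleRing.exists_ne_zero_forall_mem_mul_mem {B : Set (FiniteAdeleRing (𝓞 K) K)}
    (hB : IsCompact B) :
    ∃ d : 𝓞 K, d ≠ 0 ∧ ∀ a ∈ B, ∀ v : HeightOneSpectrum (𝓞 K),
      (algebraMap (𝓞 K) (FiniteAdeleRing (𝓞 K) K) d * a) v ∈ v.adicCompletionIntegers K := by
  classical
  -- the open sets `O d = {a : d a integral}`
  set O : 𝓞 K → Set (FiniteAdeleRing (𝓞 K) K) := fun d =>
    {a | ∀ v : HeightOneSpectrum (𝓞 K),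
      (algebraMap (𝓞 K) (FiniteAdeleRing (𝓞 K) K) d * a) v ∈ v.adicCompletionIntegers K} with hO
  have hOo : ∀ d, IsOpen (O d) := fun d =>
    (FiniteAdeleRing.isOpen_setOf_forall_mem (𝓞 K) K).preimage (continuous_const.mul continuous_id)
  have hcover : B ⊆ ⋃ d ∈ {d : 𝓞 K | d ≠ 0}, O d := by
    intro a _
    obtain ⟨d, hd, hda⟩ := FiniteAdeleRing.exists_ne_zero_forall_mul_mem (𝓞 K) K a
    exact Set.mem_biUnion hd hda
  obtain ⟨t, ht, htf, htc⟩ := hB.elim_finite_subcover_image (fun d _ => hOo d) hcover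
  refine ⟨∏ d ∈ htf.toFinset, d, ?_, fun a ha v => ?_⟩
  · exact Finset.prod_ne_zero_iff.2 fun d hd => ht (htf.mem_toFinset.1 hd)
  · obtain ⟨d, hd, hda⟩ := Set.mem_iUnion₂.1 (htc ha)
    have hdt : d ∈ htf.toFinset := htf.mem_toFinset.2 hd
    rw [← Finset.mul_prod_erase _ _ hdt, map_mul, mul_comm (algebraMap _ _ d), mul_assoc]
    change (algebraMap (𝓞 K) (FiniteAdeleRing (𝓞 K) K) (∏ x ∈ htf.toFinset.erase d, x)) v *
      (algebraMap (𝓞 K) (FiniteAdeleRing (𝓞 K) K) d * a) v ∈ _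
    refine mul_mem ?_ (hda v)
    erw [FiniteAdeleRing.algebraMap_int_apply]
    exact algebraMap_mem_adicCompletionIntegers (𝓞 K) K v _

/-- **Small rational adeles vanish.** For a compact set `B ⊆ 𝔸_K^∞` of finite adeles there is a
neighbourhood `W` of `0` in `K_∞` such that an element `k ∈ K` whose finite component lies in `B`
and whose archimedean component lies in `W` is `0`: with a common denominator `d ≠ 0` of `B`
(`FiniteAdeleRing.exists_ne_zero_forall_mem_mul_mem`), `d k` is integral at all finite places,
hence a global integer (`exists_algebraMap_eq_of_forall_coe_mem`), and it is small at the
archimedean places, hence `0` by the discreteness of `𝓞 K` in `K_∞`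
(`InfiniteAdeleRing.exists_isOpen_forall_integer_eq_zero`). This is the quantitative form of the
discreteness of `K` in `𝔸_K` that reduction theory uses (Cassels–Fröhlich II §14; Godement,
Sém. Bourbaki 257, Lemma 3; Getz–Hahn (2024), proof of Lemma 9.4.2: "if `a ∈ A_F^×` satisfies
`|a| ≥ p^{c_ω}` then `F + aω = 𝔸_F`" is the dual statement). [cite: CasselsFrohlichANT1967, Ch. II §14 Theorem] -/
theorem exists_nhds_forall_algebraMap_eq_zero {B : Set (FiniteAdeleRing (𝓞 K) K)}
    (hB : IsCompact B) :
    ∃ W ∈ 𝓝 (0 : InfiniteAdeleRing K), ∀ k : K,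
      (algebraMap K (AdeleRing (𝓞 K) K) k).2 ∈ B →
        (algebraMap K (AdeleRing (𝓞 K) K) k).1 ∈ W → k = 0 := by
  obtain ⟨d, hd0, hd⟩ := FiniteAdeleRing.exists_ne_zero_forall_mem_mul_mem K hB
  obtain ⟨V, hVo, hV0, hV⟩ := InfiniteAdeleRing.exists_isOpen_forall_integer_eq_zero K
  -- `W = {x : d x ∈ V}`
  set W : Set (InfiniteAdeleRing K) :=
    (fun x => algebraMap K (InfiniteAdeleRing K) (d : K) * x) ⁻¹' V with hW
  have hWo : IsOpen W := hVo.preimage (continuous_const.mul continuous_id)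
  have hW0 : (0 : InfiniteAdeleRing K) ∈ W := by
    change algebraMap K (InfiniteAdeleRing K) (d : K) * 0 ∈ V
    rw [mul_zero]
    exact hV0
  refine ⟨W, hWo.mem_nhds hW0, fun k hkf hkinf => ?_⟩
  -- `d k` is a global integer
  have hint : ∀ v : HeightOneSpectrum (𝓞 K),
      (((d : K) * k : K) : v.adicCompletion K) ∈ v.adicCompletionIntegers K := by
    intro v
    have h := hd _ hkf v
    have h1 : algebraMap (𝓞 K) (FiniteAdeleRing (𝓞 K) K) d *
        (algebraMap K (AdeleRing (𝓞 K) K) k).2 =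
        algebraMap K (FiniteAdeleRing (𝓞 K) K) ((d : K) * k) := by
      rw [AdeleRing.algebraMap_snd, map_mul,
        IsScalarTower.algebraMap_apply (𝓞 K) K (FiniteAdeleRing (𝓞 K) K)]
    rw [h1] at h
    rw [adicCompletion_coe_eq_algebraMap]
    exact h
  obtain ⟨m, hm⟩ := exists_algebraMap_eq_of_forall_coe_mem (𝓞 K) K ((d : K) * k) hint
  -- and it is small at the archimedean places
  have hminf : algebraMap K (InfiniteAdeleRing K) m ∈ V := by
    have h : algebraMap K (InfiniteAdeleRing K) (d : K) * (algebraMap K (AdeleRing (𝓞 K) K) k).1 ∈ V :=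
      hkinf
    rw [AdeleRing.algebraMap_fst, ← map_mul] at h
    have hm' : (algebraMap (𝓞 K) K m : K) = (d : K) * k := hm
    rw [show (m : K) = (d : K) * k from hm']
    exact h
  have hm0 : m = 0 := hV m hminf
  have hdk : (d : K) * k = 0 := by
    rw [← hm, hm0, map_zero]
  rcases mul_eq_zero.1 hdk with h | h
  · exact absurd h (by exact_mod_cast hd0)
  · exact h

end Finite

section Infinite

variable (K : Type) [Field K] [NumberField K]

omit [NumberField K] in
/-- **Real rescaling of bounded archimedean adeles is small.** For a neighbourhood `W` of `0` in
`K_∞`, a compact `B ⊆ K_∞` and `L ∈ ℕ` there is `ε > 0` such that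
`Σ_{l<L} realToInfiniteAdele(r_l) · b_l ∈ W` whenever `|r_l| ≤ ε` and `b_l ∈ B` for all `l`
(the sum is a continuous function of `(r, b) ∈ ℝ^L × K_∞^L` vanishing on the compact `{0} × B^L`;
tube lemma). [folklore] -/
theorem exists_pos_forall_sum_realToInfiniteAdele_mul_mem {W : Set (InfiniteAdeleRing K)}
    (hW : W ∈ 𝓝 (0 : InfiniteAdeleRing K)) {B : Set (InfiniteAdeleRing K)} (hB : IsCompact B)
    (L : ℕ) :
    ∃ ε : ℝ, 0 < ε ∧ ∀ (r : Fin L → ℝ) (b : Fin L → InfiniteAdeleRing K),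
      (∀ l, |r l| ≤ ε) → (∀ l, b l ∈ B) →
        ∑ l, realToInfiniteAdele K (r l) * b l ∈ W := by
  obtain ⟨W', hW'W, hW'o, hW'0⟩ := mem_nhds_iff.1 hW
  let Φ : (Fin L → ℝ) × (Fin L → InfiniteAdeleRing K) → InfiniteAdeleRing K :=
    fun p => ∑ l, realToInfiniteAdele K (p.1 l) * p.2 l
  have hΦc : Continuous Φ := by
    refine continuous_finsetSum _ fun l _ => ?_
    exact ((continuous_realToInfiniteAdele K).comp
      ((continuous_apply l).comp continuous_fst)).mul ((continuous_apply l).comp continuous_snd)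
  have hΦ0 : ∀ b : Fin L → InfiniteAdeleRing K, Φ (0, b) = 0 := by
    intro b
    refine Finset.sum_eq_zero fun l _ => ?_
    change realToInfiniteAdele K ((0 : Fin L → ℝ) l) * b l = 0
    rw [Pi.zero_apply, map_zero, zero_mul]
  have hBL : IsCompact (Set.pi Set.univ fun _ : Fin L => B) := isCompact_univ_pi fun _ => hB
  have hsub : ({0} : Set (Fin L → ℝ)) ×ˢ (Set.pi Set.univ fun _ : Fin L => B) ⊆ Φ ⁻¹' W' := by
    rintro ⟨r, b⟩ ⟨hr, -⟩
    rw [Set.mem_singleton_iff] at hr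
    subst hr
    change Φ (0, b) ∈ W'
    rw [hΦ0]
    exact hW'0
  obtain ⟨u, v, hu, -, h0u, hBv, huv⟩ :=
    generalized_tube_lemma isCompact_singleton hBL (hW'o.preimage hΦc) hsub
  have hu0 : u ∈ 𝓝 (0 : Fin L → ℝ) := hu.mem_nhds (h0u (Set.mem_singleton 0))
  obtain ⟨ε, hε, hball⟩ := Metric.mem_nhds_iff.1 hu0
  refine ⟨ε / 2, by positivity, fun r b hr hb => ?_⟩
  have hru : r ∈ u := by
    refine hball ?_
    rw [mem_ball_zero_iff, pi_norm_lt_iff hε]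
    intro l
    rw [Real.norm_eq_abs]
    exact lt_of_le_of_lt (hr l) (by linarith)
  have hbv : b ∈ v := hBv (Set.mem_univ_pi.2 fun l => hb l)
  have hmem : (r, b) ∈ Φ ⁻¹' W' := huv (Set.mk_mem_prod hru hbv)
  rw [Set.mem_preimage] at hmem
  exact hW'W hmem

end Infinite

end Literature.NumberTheory.Automorphic
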